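import Summits.AtomisticToContinuum.Crystallization.Theorems.FrustratedLawDichotomyExemptAbsorptionRecord

/-!
# FrustratedLawDichotomy — the COLLAR CENSUS (decomp-a2c lens-5 · g40 · item 27623 `AperiodicFrustratedLawGap`)

**ERRATUM (g40) on the motif census pieces** `StrainedPatchMotifPricingCapX`, `CrowdedCoreMotifPricingCap`, `DiluteDefectMotifPricingCap`
(`…ExemptAbsorptionRecord` §4) and on `TightFreeDefectMotifPricingCap` / `StrainedPatchMotifPricingCap` (`…AveragingRuleTightFree`):
every one of them reads its flags (tight / exempt / bad / crowded) on the MEMBERS of the ball `B(c, ρ)` only, while the priced feature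
`surplusCap … W₄₅ …` of a member ranges to `R_W = 9/2`; the non-members of the motif are constrained by `Sep` (hard core `7/10`) alone.
The EXTERIOR-PILE counter-motif (numerical, g40 `state/W5…W8.json`, `scripts/pile.py`): an honest equilibrium ball and its first collar
(all members `(ε, s)`-move-stable, removal-stable, not `1/20`-good) surrounded, beyond distance `1.65` from every member, by a compressed
`7/10`·(1.03)-spaced pile filling the annulus out to `ρ + 9/2`: the members keep all their flags and their `shellCount`, and every member's
surplus drops by `≈ 1e-2` — `S_c(9/5) = −6.7e-3` (all-strained ball, piece F1^X), `−6.9e-3` (crowded ball, piece CC), `−4.7e-3` (piece DD),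
`−6.0e-3` with a 1449-point motif. So the three pieces (and hand-2's originals) are FALSE-SUSPECT AS TYPED at the literal of record; the
cluster-level statements (`Topt♭`, `SchurTopologicalPricingX`, the OptimalityCut) are untouched (there the pile atoms are exempt and paid by `D_T·#Ex`).

**REPAIR typed here: the COLLAR exemption.** `Collar r ExM j :⟺ some ExM-site within r of j`. With `r = R_W = 9/2` a ball is excused as soon
as ANY site entering a member's priced feature fails the equilibrium tests, i.e. the census runs over motifs whose whole `R_W`-collar is an
`(ε, s)`-move equilibrium with bulk-like binding — exactly the class the g38–g40 FIRE batteries sample. The bridge survives with a COUNT in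
place of the pointwise domination: `Σ_j 𝟙[Collar r ExM j] ≤ Mball r · #{ExM}` under `Sep` (`sum_flag_collar_le`), so `Topt♭` is reached with
`D_T := Mball r · C_T⁰` (`schurTopologicalPricingX_of_ballAveragedCapX_collar`); the collar flag is `(ρ₁ + r)`-local (`flag_collar_isLocal`).
Record node (§3): `aperiodicFrustratedLawGap_of_collarPieces_record` — the SAME three piece predicates at
`ExM♯ := Collar (9/2) (NonEquilibriumCore (−0.7175) (1/10000) 7 (1/20) (1/10000))`, literal `(ρ, D, ρ₁ + r, ϱ) = (9/5, 3/2, 23/2, 133/10)`.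
§4: the collared census object is WEAKER than the g39 one (`equilibriumMotifPricingCap_collar_of_uncollared`, through the cluster-level book).
All theorems are folklore bookkeeping / chaining; tags in the docstrings.
-/

noncomputable section

namespace Summit.AtomisticToContinuum.Crystallization.Theorems.FrustratedLawDichotomyCollarCensus

open scoped BigOperators Classical
open Literature.MathematicalPhysics.StatisticalMechanics (interactionEnergy siteEnergy lennardJones)
open Summit.AtomisticToContinuum.Crystallization.Theorems.ChargedEnergyGapNegative (E3 eStar)
open Summit.AtomisticToContinuum.Crystallization.Theorems.FrustratedLawDichotomyRangeCut
open Summit.AtomisticToContinuum.Crystallization.Theorems.FrustratedLawDichotomySchurCut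
open Summit.AtomisticToContinuum.Crystallization.Theorems.FrustratedLawDichotomyMotifLemmas
open Summit.AtomisticToContinuum.Crystallization.Theorems.FrustratedLawDichotomyRuleToolkit
open Summit.AtomisticToContinuum.Crystallization.Theorems.FrustratedLawDichotomyRuleToolkitGood
open Summit.AtomisticToContinuum.Crystallization.Theorems.FrustratedLawDichotomyAveragingCut
  (surplus ball ballAvg mem_ball card_ball_pos one_le_card_ball card_ball_le sum_ballAvg sum_surplus BallAveragedPricing
   CutBounds Mball one_le_Mball Dfl Dfl_pos CT₀ Dfl_le_CT₀ W₄₅ e₄₅ CT₄₅ W₄₅_cutBounds)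
open Summit.AtomisticToContinuum.Crystallization.Theorems.FrustratedLawDichotomyAveragingRule
open Summit.AtomisticToContinuum.Crystallization.Theorems.FrustratedLawDichotomyAveragingRuleCap
open Summit.AtomisticToContinuum.Crystallization.Theorems.FrustratedLawDichotomyAveragingRuleTightFree
open Summit.AtomisticToContinuum.Crystallization.Theorems.FrustratedLawDichotomyExemptDoor (SitePred)
open Summit.AtomisticToContinuum.Crystallization.Theorems.FrustratedLawDichotomyExemptLocOpt (LocOpt LocOptFails)
open Summit.AtomisticToContinuum.Crystallization.Theorems.FrustratedLawDichotomyExemptSplit (SchurTopologicalPricingX)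
open Summit.AtomisticToContinuum.Crystallization.Theorems.FrustratedLawDichotomyOptimalityCut
  (ToptFourHalf EoptFourHalf aperiodicFrustratedLawGap_of_optimalityCut_fourHalf periodicFrustratedLawGap_of_optimalityCut_fourHalf)
open Summit.AtomisticToContinuum.Crystallization.Theorems.FrustratedLawDichotomyExemptAbsorption
open Summit.AtomisticToContinuum.Crystallization.Theorems.FrustratedLawDichotomyExemptAbsorptionRecord

/-! ## §1. The collar flag: definition, monotonicity, locality -/

/-- **`Collar r P`** — some `P`-site within distance `r` of `j` (for `r ≥ 0` it contains `P` itself). -/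
def Collar (r : ℝ) (P : SitePred) : SitePred := fun N y j => ∃ k ∈ ball r y j, P N y k

/-- `P ⟹ Collar r P` (`r ≥ 0`). [folklore] -/
theorem collar_of_self {r : ℝ} (hr : 0 ≤ r) {P : SitePred} {N : ℕ} {y : Fin N → E3} {j : Fin N} (h : P N y j) : Collar r P N y j :=
  ⟨j, by rw [mem_ball, dist_self]; exact hr, h⟩

/-- `Collar r` is monotone in the predicate. [folklore] -/
theorem Collar.mono {r : ℝ} {P Q : SitePred} (h : ∀ (N : ℕ) (y : Fin N → E3) (j : Fin N), P N y j → Q N y j) {N : ℕ} {y : Fin N → E3}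
    {j : Fin N} (hc : Collar r P N y j) : Collar r Q N y j := by
  obtain ⟨k, hk, hP⟩ := hc
  exact ⟨k, hk, h N y k hP⟩

/-- A `ρ₁`-local flag decides its predicate on motifs (the `iff` behind `IsLocalFeature ρ₁ (flag P)`). [folklore] -/
theorem iff_of_isLocalFeature_flag {ρ₁ : ℝ} {P : SitePred} (h : IsLocalFeature ρ₁ (flag P)) {N M : ℕ} {y : Fin N → E3} {φ : Fin M → Fin N}
    (hφ : Function.Injective φ) {a : Fin M} (hS : ∀ k : Fin N, dist (y k) (y (φ a)) ≤ ρ₁ → k ∈ Set.range φ) :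
    P M (y ∘ φ) a ↔ P N y (φ a) := by
  have h1 := h N M y φ hφ a hS
  unfold flag at h1
  by_cases ha : P M (y ∘ φ) a <;> by_cases hb : P N y (φ a) <;> simp_all

/-- **The collar of a `ρ₁`-local flag is decided on `(ρ₁ + r)`-motifs.** [folklore] -/
theorem collar_iff_motif {r ρ₁ : ℝ} (hρ₁ : 0 ≤ ρ₁) {P : SitePred} (hP : IsLocalFeature ρ₁ (flag P)) {N M : ℕ} {y : Fin N → E3}
    {φ : Fin M → Fin N} (hφ : Function.Injective φ) {a : Fin M} (hS : ∀ k : Fin N, dist (y k) (y (φ a)) ≤ ρ₁ + r → k ∈ Set.range φ) :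
    Collar r P M (y ∘ φ) a ↔ Collar r P N y (φ a) := by
  constructor
  · rintro ⟨b, hb, hPb⟩
    rw [mem_ball] at hb
    simp only [Function.comp_apply] at hb
    have hSb : ∀ k : Fin N, dist (y k) (y (φ b)) ≤ ρ₁ → k ∈ Set.range φ := fun k hk =>
      hS k ((dist_triangle (y k) (y (φ b)) (y (φ a))).trans (by linarith))
    exact ⟨φ b, by rw [mem_ball]; exact hb, (iff_of_isLocalFeature_flag hP hφ hSb).1 hPb⟩
  · rintro ⟨k, hk, hPk⟩
    rw [mem_ball] at hk
    obtain ⟨b, rfl⟩ := hS k (hk.trans (by linarith))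
    have hSb : ∀ k : Fin N, dist (y k) (y (φ b)) ≤ ρ₁ → k ∈ Set.range φ := fun k hk' =>
      hS k ((dist_triangle (y k) (y (φ b)) (y (φ a))).trans (by linarith))
    exact ⟨b, by rw [mem_ball]; simpa using hk, (iff_of_isLocalFeature_flag hP hφ hSb).2 hPk⟩

/-- ★ **The collar flag of a `ρ₁`-local flag is `(ρ₁ + r)`-local.** [folklore] -/
theorem flag_collar_isLocal {r ρ₁ : ℝ} (hρ₁ : 0 ≤ ρ₁) {P : SitePred} (hP : IsLocalFeature ρ₁ (flag P)) :
    IsLocalFeature (ρ₁ + r) (flag (Collar r P)) :=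
  isLocalFeature_flag_of_iff fun _ _ _ _ hφ _ hS => collar_iff_motif hρ₁ hP hφ hS

/-! ## §2. The collar count and the bridge with a count -/

/-- ★ **Collar count under the hard core**: `Σ_j 𝟙[Collar r P j] ≤ Mball r · #{j : P j}` (each `P`-site collars at most `#B(k, r) ≤ Mball r` sites).
[folklore] -/
theorem sum_flag_collar_le {r : ℝ} (hr : 0 ≤ r) {P : SitePred} {N : ℕ} {y : Fin N → E3} (hs : Sep y) :
    ∑ j, flag (Collar r P) N y j ≤ Mball r * (Nat.card {j : Fin N // P N y j} : ℝ) := by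
  classical
  set F : Finset (Fin N) := Finset.univ.filter (fun k => P N y k) with hF
  have h1 : ∀ j : Fin N, flag (Collar r P) N y j ≤ ∑ k ∈ F, (if dist (y k) (y j) ≤ r then (1 : ℝ) else 0) := by
    intro j
    have hnn : ∀ i ∈ F, (0 : ℝ) ≤ (if dist (y i) (y j) ≤ r then (1 : ℝ) else 0) := fun i _ => by split_ifs <;> norm_num
    unfold flag
    split_ifs with h
    · obtain ⟨k, hk, hP⟩ := h
      rw [mem_ball] at hk
      have hmem : k ∈ F := by rw [hF, Finset.mem_filter]; exact ⟨Finset.mem_univ _, hP⟩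
      calc (1 : ℝ) = (if dist (y k) (y j) ≤ r then (1 : ℝ) else 0) := by rw [if_pos hk]
        _ ≤ ∑ k ∈ F, (if dist (y k) (y j) ≤ r then (1 : ℝ) else 0) := Finset.single_le_sum hnn hmem
    · exact Finset.sum_nonneg hnn
  have h2 : ∀ k : Fin N, ∑ j, (if dist (y k) (y j) ≤ r then (1 : ℝ) else 0) = ((ball r y k).card : ℝ) := by
    intro k
    rw [Finset.sum_boole]
    congr 2
    ext j
    simp only [Finset.mem_filter, Finset.mem_univ, true_and, mem_ball, dist_comm]
  have h3 : (F.card : ℝ) = (Nat.card {j : Fin N // P N y j} : ℝ) := by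
    rw [Nat.card_eq_fintype_card, Fintype.card_subtype, hF]
  calc ∑ j, flag (Collar r P) N y j ≤ ∑ j, ∑ k ∈ F, (if dist (y k) (y j) ≤ r then (1 : ℝ) else 0) := Finset.sum_le_sum fun j _ => h1 j
    _ = ∑ k ∈ F, ∑ j, (if dist (y k) (y j) ≤ r then (1 : ℝ) else 0) := Finset.sum_comm
    _ = ∑ k ∈ F, ((ball r y k).card : ℝ) := Finset.sum_congr rfl fun k _ => h2 k
    _ ≤ ∑ k ∈ F, Mball r := Finset.sum_le_sum fun k _ => by unfold Mball; exact card_ball_le hr hs k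
    _ = Mball r * (Nat.card {j : Fin N // P N y j} : ℝ) := by rw [Finset.sum_const, nsmul_eq_mul, mul_comm, h3]

/-- `Σ_j x^X_j ≤ Σ W − e·N − κ_T·(N − ℓ) + C_T·g + (K·D_T)·#Ex` from a COUNT `Σ_j 𝟙[ExM j] ≤ K·#Ex` (the pointwise `ExM ⟹ Ex` of `sum_surplusCapX_le`
is the case `K = 1`). [folklore] -/
theorem sum_surplusCapX_le_count {η₀ η₁ D : ℝ} {W : ℝ → ℝ} {e κT CT DT K : ℝ} {ExM Ex : SitePred} (hκ : 0 ≤ κT) (hC : 0 ≤ CT) (hDT : 0 ≤ DT)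
    {N : ℕ} (y : Fin N → E3) (hK : ∑ j, flag ExM N y j ≤ K * (Nat.card {j : Fin N // Ex N y j} : ℝ)) :
    ∑ j, surplusCapX η₀ η₁ D W e κT CT DT ExM N y j ≤
      interactionEnergy W y - e * N - κT * (N - goodCount η₁ y) + CT * goodCount η₀ y + K * DT * (Nat.card {j : Fin N // Ex N y j} : ℝ) := by
  have h1 : ∑ j, surplusCapX η₀ η₁ D W e κT CT DT ExM N y j =
      (∑ j, surplusCap η₀ η₁ D W e κT CT N y j) + DT * ∑ j, flag ExM N y j := by
    unfold surplusCapX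
    rw [Finset.sum_add_distrib, Finset.mul_sum]
  have h2 : ∑ j, surplusCap η₀ η₁ D W e κT CT N y j ≤ ∑ j, surplus η₀ η₁ W e κT CT y j :=
    Finset.sum_le_sum fun j _ => surplusCap_le_surplus hκ hC N y j
  rw [sum_surplus] at h2
  rw [h1]
  nlinarith [mul_le_mul_of_nonneg_left hK hDT]

/-- ★★ **THE BRIDGE WITH THE COLLAR**: a nonnegative X ball book at the collar exemption `Collar r ExM` gives `Topt♭`-type pricing with the
cluster-level exempt count `#Ex` (`ExM ⟹ Ex` pointwise on injective `Sep` clusters) and the constant `D_T·Mball r` (`ρ, r ≥ 0`). [folklore] -/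
theorem schurTopologicalPricingX_of_ballAveragedCapX_collar {ρ r η₀ η₁ D A eUp κT CT DT : ℝ} {w ω : ℝ → ℝ} {ExM Ex : SitePred}
    (hρ : 0 ≤ ρ) (hr : 0 ≤ r) (hκ : 0 ≤ κT) (hC : 0 ≤ CT) (hDT : 0 ≤ DT)
    (hImp : ∀ (N : ℕ) (y : Fin N → E3), Function.Injective y → Sep y → ∀ j : Fin N, ExM N y j → Ex N y j)
    (h : BallAveragedPricingCapX ρ η₀ η₁ D (effPot w ω A) (eUp + A) κT CT DT (Collar r ExM)) :
    SchurTopologicalPricingX η₀ η₁ w ω A eUp κT CT (Mball r * DT) Ex := by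
  intro N y hy hs
  have hsum : 0 ≤ ∑ i, ballAvg ρ y (surplusCapX η₀ η₁ D (effPot w ω A) (eUp + A) κT CT DT (Collar r ExM) N y) i :=
    Finset.sum_nonneg fun i _ => h N y hy hs i
  rw [sum_ballAvg hρ] at hsum
  have hcard : (Nat.card {j : Fin N // ExM N y j} : ℝ) ≤ Nat.card {j : Fin N // Ex N y j} := by
    exact_mod_cast Nat.card_le_card_of_injective
      (fun i : {j : Fin N // ExM N y j} => (⟨i.1, hImp N y hy hs i.1 i.2⟩ : {j : Fin N // Ex N y j}))
      fun a b hab => Subtype.ext (by simpa using congrArg Subtype.val hab)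
  have hM : 0 ≤ Mball r := zero_le_one.trans (one_le_Mball hr)
  have hK : ∑ j, flag (Collar r ExM) N y j ≤ Mball r * (Nat.card {j : Fin N // Ex N y j} : ℝ) :=
    (sum_flag_collar_le hr hs).trans (mul_le_mul_of_nonneg_left hcard hM)
  have hle := sum_surplusCapX_le_count (η₀ := η₀) (η₁ := η₁) (D := D) (W := effPot w ω A) (e := eUp + A) hκ hC hDT y hK
  unfold interactionEnergy at hle ⊢
  linarith

/-- ★ **Motif form of the collar bridge** (`ϱ ≥ ρ + ρ₂`, the collar flag `ρ₂`-local, locality side conditions of the X book). [folklore chaining] -/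
theorem schurTopologicalPricingX_of_ballAveragedMotifCapX_collar {η₀ η₁ D A eUp κT CT DT R ρ r ρ₂ ϱ : ℝ} {w ω : ℝ → ℝ} {ExM Ex : SitePred}
    (hW : ∀ t, R ≤ t → effPot w ω A t = 0) (hη₀ : η₀ ≤ 3 / 10) (hη₁ : η₁ ≤ 3 / 10) (h0 : 0 ≤ ρ) (hr : 0 ≤ r) (hρ : ρ ≤ ρ₂) (hR : R ≤ ρ₂)
    (hD : 13 / 10 * D + 1 ≤ ρ₂) (hϱ : ρ + ρ₂ ≤ ϱ) (hEx : IsLocalFeature ρ₂ (flag (Collar r ExM))) (hκ : 0 ≤ κT) (hC : 0 ≤ CT) (hDT : 0 ≤ DT)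
    (hImp : ∀ (N : ℕ) (y : Fin N → E3), Function.Injective y → Sep y → ∀ j : Fin N, ExM N y j → Ex N y j)
    (h : BallAveragedMotifPricingCapX ρ ϱ η₀ η₁ D (effPot w ω A) (eUp + A) κT CT DT (Collar r ExM)) :
    SchurTopologicalPricingX η₀ η₁ w ω A eUp κT CT (Mball r * DT) Ex :=
  schurTopologicalPricingX_of_ballAveragedCapX_collar h0 hr hκ hC hDT hImp
    ((ballAveragedPricingCapX_iff_motif hW hη₀ hη₁ h0 hρ hR hD hϱ hEx).2 h)

/-- ★★ **`Topt♭-type pricing ⟸ EquilibriumMotifPricingCap at the collar exemption`** (`C_T = D_T(X book) := C_T⁰`, cluster constant `Mball r · C_T⁰`;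
`ExM` `ρ₁`-local, `ρ₂ = ρ₁ + r`). [folklore chaining] -/
theorem schurTopologicalPricingX_of_collarMotifCap {w ω : ℝ → ℝ} {A eUp R B R' ρ r ρ₁ ϱ D : ℝ} {ExM Ex : SitePred}
    (hWB : CutBounds (effPot w ω A) R B) (hW : ∀ t, R' ≤ t → effPot w ω A t = 0) (h0 : 0 ≤ ρ) (hr : 0 ≤ r) (h1 : 0 ≤ ρ₁) (hρ : ρ ≤ ρ₁ + r)
    (hR : R' ≤ ρ₁ + r) (hD : 13 / 10 * D + 1 ≤ ρ₁ + r) (hϱ : ρ + (ρ₁ + r) ≤ ϱ) (hEx : IsLocalFeature ρ₁ (flag ExM))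
    (hImp : ∀ (N : ℕ) (y : Fin N → E3), Function.Injective y → Sep y → ∀ j : Fin N, ExM N y j → Ex N y j)
    (h : EquilibriumMotifPricingCap ρ ϱ D (effPot w ω A) (eUp + A) (Collar r ExM)) :
    SchurTopologicalPricingX (1 / 20) (1 / 8) w ω A eUp (1 / 100) (CT₀ R B (eUp + A) ρ) (Mball r * CT₀ R B (eUp + A) ρ) Ex :=
  have hC : 0 ≤ CT₀ R B (eUp + A) ρ :=
    (Dfl_pos hWB.range_nonneg hWB.floor_nonneg).le.trans (Dfl_le_CT₀ hWB.range_nonneg hWB.floor_nonneg ρ)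
  schurTopologicalPricingX_of_ballAveragedMotifCapX_collar hW (by norm_num) (by norm_num) h0 hr hρ hR hD hϱ (flag_collar_isLocal h1 hEx)
    (by norm_num) hC hC hImp (ballAveragedMotifPricingCapX_of_equilibrium hWB h0 le_rfl le_rfl h)

/-! ## §3. The record node at the collar exemption -/

/-- **`CollarCore r eUp ε Rm s t := Collar r (NonEquilibriumCore eUp ε Rm s t)`** — a site is exempt as soon as SOME site within `r` of it fails the
one-atom move test or the removal test (the exemption of record from g40 on, `r = R_W = 9/2`). -/
def CollarCore (r eUp ε Rm s t : ℝ) : SitePred := Collar r (NonEquilibriumCore eUp ε Rm s t)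

/-- Its flag is `(ρ₁ + r)`-local (`Rm ≤ ρ₁`, `0 ≤ ρ₁`). [folklore] -/
theorem flag_collarCore_isLocal {r eUp ε Rm s t ρ₁ : ℝ} (h1 : 0 ≤ ρ₁) (hRm : Rm ≤ ρ₁) :
    IsLocalFeature (ρ₁ + r) (flag (CollarCore r eUp ε Rm s t)) :=
  flag_collar_isLocal h1 (flag_nonEquilibriumCore_isLocal hRm)

/-- ★★ **`Topt♭₄₅(ε, ϱ′, 1; C_T⁴⁵(ρ), Mball r·C_T⁴⁵(ρ)) ⟸ EquilibriumMotifPricingCap ρ ϱ D W₄₅ e₄₅ (CollarCore r (−0.7175) ε Rm s t)`**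
(`e⋆ ≤ −0.7175`, `0 ≤ ρ ≤ ρ₁ + r`, `0 ≤ r`, `0 ≤ ρ₁`, `9/2 ≤ ρ₁ + r`, `13/10·D + 1 ≤ ρ₁ + r`, `Rm ≤ ρ₁`, `ρ + (ρ₁ + r) ≤ ϱ`, `1 + s ≤ Rm`, `0 ≤ s ≤ ϱ′`, `ε ≤ t`).
[folklore chaining] -/
theorem toptFourHalf_of_collarMotifCap {ρ r ρ₁ ϱ D ε Rm s t ϱ' : ℝ} (hUp : eStar ≤ -(7175 / 10000)) (h0 : 0 ≤ ρ) (hr : 0 ≤ r) (h1 : 0 ≤ ρ₁)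
    (hρ : ρ ≤ ρ₁ + r) (hR : 9 / 2 ≤ ρ₁ + r) (hD : 13 / 10 * D + 1 ≤ ρ₁ + r) (hRm : Rm ≤ ρ₁) (hϱ : ρ + (ρ₁ + r) ≤ ϱ) (hRm1 : 1 + s ≤ Rm)
    (hs0 : 0 ≤ s) (hs : s ≤ ϱ') (hεt : ε ≤ t)
    (h : EquilibriumMotifPricingCap ρ ϱ D (effPot w₄₅ ω₄ (3 / 400)) (-(7175 / 10000) + 3 / 400) (CollarCore r (-(7175 / 10000)) ε Rm s t)) :
    ToptFourHalf ε ϱ' 1 (CT₄₅ ρ) (Mball r * CT₄₅ ρ) :=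
  schurTopologicalPricingX_of_collarMotifCap W₄₅_cutBounds (fun _ ht => effPot_fourHalf_eq_zero _ ht) h0 hr h1 hρ hR hD hϱ
    (flag_nonEquilibriumCore_isLocal hRm) (fun _ _ _ hsep _ hx => locOptFails_of_nonEquilibriumCore hUp hRm1 hs0 hs hεt hsep hx) h

/-- ★★★ **THE NODE «CollarCensus»: the crux `AperiodicFrustratedLawGap` (item 27623) BY NAME** from `MuEquilibriumDoor ∧ UP(−0.7175) ∧ Eopt♭₄₅(ε, ϱ′, 1; …)`
and the census object at the COLLAR exemption (side conditions of `toptFourHalf_of_collarMotifCap`, `0 < ε`, `0 ≤ D_X`). [folklore chaining] -/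
theorem aperiodicFrustratedLawGap_of_collarMotifCap {ρ r ρ₁ ϱ D ε Rm s t ϱ' CE DE DX : ℝ}
    (hDoor : Summit.AtomisticToContinuum.Crystallization.Theses.GrainCoreNetworkSplit.MuEquilibriumDoor)
    (hU : PeriodicEnergyCeiling (-(7175 / 10000))) (hε : 0 < ε) (hDX : 0 ≤ DX) (hE : EoptFourHalf ε ϱ' 1 CE DE DX)
    (h0 : 0 ≤ ρ) (hr : 0 ≤ r) (h1 : 0 ≤ ρ₁) (hρ : ρ ≤ ρ₁ + r) (hR : 9 / 2 ≤ ρ₁ + r) (hD : 13 / 10 * D + 1 ≤ ρ₁ + r) (hRm : Rm ≤ ρ₁)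
    (hϱ : ρ + (ρ₁ + r) ≤ ϱ) (hRm1 : 1 + s ≤ Rm) (hs0 : 0 ≤ s) (hs : s ≤ ϱ') (hεt : ε ≤ t)
    (h : EquilibriumMotifPricingCap ρ ϱ D (effPot w₄₅ ω₄ (3 / 400)) (-(7175 / 10000) + 3 / 400) (CollarCore r (-(7175 / 10000)) ε Rm s t)) :
    Summit.AtomisticToContinuum.Crystallization.Theses.FrustratedLawDichotomy.AperiodicFrustratedLawGap :=
  have hC : 0 ≤ CT₄₅ ρ :=
    (Dfl_pos W₄₅_cutBounds.range_nonneg W₄₅_cutBounds.floor_nonneg).le.trans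
      (Dfl_le_CT₀ W₄₅_cutBounds.range_nonneg W₄₅_cutBounds.floor_nonneg ρ)
  have hM : 0 ≤ Mball r * CT₄₅ ρ := mul_nonneg (zero_le_one.trans (one_le_Mball hr)) hC
  aperiodicFrustratedLawGap_of_optimalityCut_fourHalf hDoor hU hε hM hDX
    (toptFourHalf_of_collarMotifCap (eStar_le_of_periodicEnergyCeiling hU) h0 hr h1 hρ hR hD hRm hϱ hRm1 hs0 hs hεt h) hE

/-- The sibling item 27624 `PeriodicFrustratedLawGap` from the same node. [folklore chaining] -/
theorem periodicFrustratedLawGap_of_collarMotifCap {ρ r ρ₁ ϱ D ε Rm s t ϱ' CE DE DX : ℝ}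
    (hDoor : Summit.AtomisticToContinuum.Crystallization.Theses.GrainCoreNetworkSplit.MuEquilibriumDoor)
    (hU : PeriodicEnergyCeiling (-(7175 / 10000))) (hε : 0 < ε) (hDX : 0 ≤ DX) (hE : EoptFourHalf ε ϱ' 1 CE DE DX)
    (h0 : 0 ≤ ρ) (hr : 0 ≤ r) (h1 : 0 ≤ ρ₁) (hρ : ρ ≤ ρ₁ + r) (hR : 9 / 2 ≤ ρ₁ + r) (hD : 13 / 10 * D + 1 ≤ ρ₁ + r) (hRm : Rm ≤ ρ₁)
    (hϱ : ρ + (ρ₁ + r) ≤ ϱ) (hRm1 : 1 + s ≤ Rm) (hs0 : 0 ≤ s) (hs : s ≤ ϱ') (hεt : ε ≤ t)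
    (h : EquilibriumMotifPricingCap ρ ϱ D (effPot w₄₅ ω₄ (3 / 400)) (-(7175 / 10000) + 3 / 400) (CollarCore r (-(7175 / 10000)) ε Rm s t)) :
    Summit.AtomisticToContinuum.Crystallization.Theses.FrustratedLawDichotomy.PeriodicFrustratedLawGap :=
  have hC : 0 ≤ CT₄₅ ρ :=
    (Dfl_pos W₄₅_cutBounds.range_nonneg W₄₅_cutBounds.floor_nonneg).le.trans
      (Dfl_le_CT₀ W₄₅_cutBounds.range_nonneg W₄₅_cutBounds.floor_nonneg ρ)
  have hM : 0 ≤ Mball r * CT₄₅ ρ := mul_nonneg (zero_le_one.trans (one_le_Mball hr)) hC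
  periodicFrustratedLawGap_of_optimalityCut_fourHalf hDoor hU hε hM hDX
    (toptFourHalf_of_collarMotifCap (eStar_le_of_periodicEnergyCeiling hU) h0 hr h1 hρ hR hD hRm hϱ hRm1 hs0 hs hεt h) hE

/-- ★ **THE LITERAL OF RECORD (g40)** `(ρ, D, r, ρ₁, ϱ, ε, Rm, s, t, ϱ′) = (9/5, 3/2, 9/2, 7, 133/10, 1/10000, 7, 1/20, 1/10000, 3/2)`: the g39 literal with the
collar radius `r = R_W = 9/2` (every site entering a member's priced feature) and the motif radius `ϱ = ρ + ρ₁ + r = 133/10`. [folklore chaining] -/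
theorem aperiodicFrustratedLawGap_of_collarMotifCap_record {CE DE DX : ℝ}
    (hDoor : Summit.AtomisticToContinuum.Crystallization.Theses.GrainCoreNetworkSplit.MuEquilibriumDoor)
    (hU : PeriodicEnergyCeiling (-(7175 / 10000))) (hDX : 0 ≤ DX) (hE : EoptFourHalf (1 / 10000) (3 / 2) 1 CE DE DX)
    (h : EquilibriumMotifPricingCap (9 / 5) (133 / 10) (3 / 2) (effPot w₄₅ ω₄ (3 / 400)) (-(7175 / 10000) + 3 / 400)
      (CollarCore (9 / 2) (-(7175 / 10000)) (1 / 10000) 7 (1 / 20) (1 / 10000))) :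
    Summit.AtomisticToContinuum.Crystallization.Theses.FrustratedLawDichotomy.AperiodicFrustratedLawGap :=
  aperiodicFrustratedLawGap_of_collarMotifCap (ρ₁ := 7) hDoor hU (by norm_num) hDX hE (by norm_num) (by norm_num) (by norm_num) (by norm_num)
    (by norm_num) (by norm_num) le_rfl (by norm_num) (by norm_num) (by norm_num) (by norm_num) le_rfl h

/-- ★ **THE g40 NODE IN THREE PIECES at the literal of record**:
`MuEquilibriumDoor ∧ UP(−0.7175) ∧ Eopt♭₄₅(1/10000, 3/2, 1; …) ∧ F1^X♯ ∧ CC♯ ∧ DD♯ ⟹ AperiodicFrustratedLawGap`, the pieces being the §4 predicates of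
`…ExemptAbsorptionRecord` at the COLLAR exemption `ExM♯`. [folklore chaining] -/
theorem aperiodicFrustratedLawGap_of_collarPieces_record {CE DE DX : ℝ}
    (hDoor : Summit.AtomisticToContinuum.Crystallization.Theses.GrainCoreNetworkSplit.MuEquilibriumDoor)
    (hU : PeriodicEnergyCeiling (-(7175 / 10000))) (hDX : 0 ≤ DX) (hE : EoptFourHalf (1 / 10000) (3 / 2) 1 CE DE DX)
    (h1 : StrainedPatchMotifPricingCapX (9 / 5) (133 / 10) (3 / 2) (effPot w₄₅ ω₄ (3 / 400)) (-(7175 / 10000) + 3 / 400)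
      (CollarCore (9 / 2) (-(7175 / 10000)) (1 / 10000) 7 (1 / 20) (1 / 10000)))
    (h2 : CrowdedCoreMotifPricingCap (9 / 5) (133 / 10) (3 / 2) (effPot w₄₅ ω₄ (3 / 400)) (-(7175 / 10000) + 3 / 400)
      (CollarCore (9 / 2) (-(7175 / 10000)) (1 / 10000) 7 (1 / 20) (1 / 10000)))
    (h3 : DiluteDefectMotifPricingCap (9 / 5) (133 / 10) (3 / 2) (effPot w₄₅ ω₄ (3 / 400)) (-(7175 / 10000) + 3 / 400)
      (CollarCore (9 / 2) (-(7175 / 10000)) (1 / 10000) 7 (1 / 20) (1 / 10000))) :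
    Summit.AtomisticToContinuum.Crystallization.Theses.FrustratedLawDichotomy.AperiodicFrustratedLawGap :=
  aperiodicFrustratedLawGap_of_collarMotifCap_record hDoor hU hDX hE (equilibriumMotifPricingCap_iff_pieces.2 ⟨h1, h2, h3⟩)

/-! ## §4. The collared census object is WEAKER than the uncollared one (through the cluster-level X book) -/

/-- The X ball book is MONOTONE in the exemption predicate (a larger flag only adds `D_T ≥ 0` credits). [folklore] -/
theorem BallAveragedPricingCapX.mono {ρ η₀ η₁ D : ℝ} {W : ℝ → ℝ} {e κT CT DT : ℝ} {ExM ExM' : SitePred} (hρ : 0 ≤ ρ) (hDT : 0 ≤ DT)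
    (hle : ∀ (N : ℕ) (y : Fin N → E3) (j : Fin N), ExM N y j → ExM' N y j) (h : BallAveragedPricingCapX ρ η₀ η₁ D W e κT CT DT ExM) :
    BallAveragedPricingCapX ρ η₀ η₁ D W e κT CT DT ExM' := by
  intro N y hy hs i
  refine (h N y hy hs i).trans (Finset.sum_le_sum fun j _ => ?_)
  have hc : (0 : ℝ) < ((ball ρ y j).card : ℝ) := card_ball_pos hρ y j
  refine div_le_div_of_nonneg_right ?_ hc.le
  unfold surplusCapX flag
  have : (if ExM N y j then (1 : ℝ) else 0) ≤ (if ExM' N y j then (1 : ℝ) else 0) := by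
    by_cases h1 : ExM N y j
    · rw [if_pos h1, if_pos (hle N y j h1)]
    · rw [if_neg h1]; split_ifs <;> norm_num
  nlinarith

/-- On a tight-free exempt-free ball the X book is the plain census inequality, so the census object follows from ANY X ball book. [folklore] -/
theorem equilibriumMotifPricingCap_of_ballAveragedMotifPricingCapX {ρ ϱ D : ℝ} {W : ℝ → ℝ} {e CT DT : ℝ} {ExM : SitePred}
    (h : BallAveragedMotifPricingCapX ρ ϱ (1 / 20) (1 / 8) D W e (1 / 100) CT DT ExM) : EquilibriumMotifPricingCap ρ ϱ D W e ExM := by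
  intro M z hz hs c hconf ht hx
  rw [← ballAvg_surplusCapX_eq_of_free ht hx]
  exact h M z hz hs c hconf

/-- ★ **Uncollared ⟹ collared** for the census object: `EquilibriumMotifPricingCap ρ ϱ D W ExM` at motif radius `ϱ ≥ ρ + ρ₁` (`ExM` `ρ₁`-local, admissible
cut `W` vanishing from `R′ ≤ ρ₁`) implies the census at `Collar r ExM` for every motif radius `ϱ′ ≥ ρ + ρ₁ + r` (`r ≥ 0`) — so the g40 pieces, jointly, are
WEAKER than the g39 pieces jointly. [folklore chaining] -/
theorem equilibriumMotifPricingCap_collar_of_uncollared {W : ℝ → ℝ} {R B R' e ρ r ρ₁ ϱ ϱ' D : ℝ} {ExM : SitePred} (hWB : CutBounds W R B)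
    (hW : ∀ t, R' ≤ t → W t = 0) (h0 : 0 ≤ ρ) (hr : 0 ≤ r) (h1 : 0 ≤ ρ₁) (hρ : ρ ≤ ρ₁) (hR : R' ≤ ρ₁) (hD : 13 / 10 * D + 1 ≤ ρ₁) (hϱ : ρ + ρ₁ ≤ ϱ)
    (hϱ' : ρ + (ρ₁ + r) ≤ ϱ') (hEx : IsLocalFeature ρ₁ (flag ExM)) (h : EquilibriumMotifPricingCap ρ ϱ D W e ExM) :
    EquilibriumMotifPricingCap ρ ϱ' D W e (Collar r ExM) := by
  have hX := ballAveragedMotifPricingCapX_of_equilibrium hWB h0 le_rfl le_rfl h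
  have hcl := (ballAveragedPricingCapX_iff_motif hW (by norm_num) (by norm_num) h0 hρ hR hD hϱ hEx).2 hX
  have hC : 0 ≤ CT₀ R B e ρ := (Dfl_pos hWB.range_nonneg hWB.floor_nonneg).le.trans (Dfl_le_CT₀ hWB.range_nonneg hWB.floor_nonneg ρ)
  have hcl' := BallAveragedPricingCapX.mono h0 hC (fun N y j hj => collar_of_self hr hj) hcl
  have hX' := (ballAveragedPricingCapX_iff_motif hW (by norm_num) (by norm_num) h0 (hρ.trans (by linarith)) (hR.trans (by linarith))
    (hD.trans (by linarith)) hϱ' (flag_collar_isLocal h1 hEx)).1 hcl'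
  exact equilibriumMotifPricingCap_of_ballAveragedMotifPricingCapX hX'

/-- At the literals: the g39 census object (`ϱ = 44/5`, uncollared) implies the g40 one (`ϱ = 133/10`, collar `9/2`). [folklore chaining] -/
theorem equilibriumMotifPricingCap_record_collar_of_g39
    (h : EquilibriumMotifPricingCap (9 / 5) (44 / 5) (3 / 2) (effPot w₄₅ ω₄ (3 / 400)) (-(7175 / 10000) + 3 / 400)
      (NonEquilibriumCore (-(7175 / 10000)) (1 / 10000) 7 (1 / 20) (1 / 10000))) :
    EquilibriumMotifPricingCap (9 / 5) (133 / 10) (3 / 2) (effPot w₄₅ ω₄ (3 / 400)) (-(7175 / 10000) + 3 / 400)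
      (CollarCore (9 / 2) (-(7175 / 10000)) (1 / 10000) 7 (1 / 20) (1 / 10000)) :=
  equilibriumMotifPricingCap_collar_of_uncollared (ρ₁ := 7) W₄₅_cutBounds (fun _ ht => effPot_fourHalf_eq_zero _ ht) (by norm_num) (by norm_num)
    (by norm_num) (by norm_num) (by norm_num) (by norm_num) (by norm_num) (by norm_num) (flag_nonEquilibriumCore_isLocal le_rfl) h

end Summit.AtomisticToContinuum.Crystallization.Theorems.FrustratedLawDichotomyCollarCensus

end
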